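import Summits.QuantumFields.YangMills.Theorems.UnitScaleTiltProp7CovOfThm2
import Summits.QuantumFields.YangMills.Theorems.UnitScaleTiltProp7ChartPrint
import Summits.QuantumFields.YangMills.Theorems.UnitScaleTiltProp7TPrintDefs
import HarnessLib

/-!
# Route `UnitScaleTilt`, crux K1 child «MinimiserStabilityRegPr» (stmt-QuantumFields-19200), skeleton v10, stub `stub_existenceMinimalOrbit` (EX), route (α) — **CHART_W FROM
# THE KNIT'S OWN THEOREM-2 SOCKET READ AT THE CRITICAL BACKGROUND** (EX knit v3.1ˢ, file W4a; knit lineage LOCATE 2026-08-28 11:47Z): the displayed row CHART_W of the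
# knit of record v3.0ˢ (✓`Prop7StubEXOfChartPiecesTwS3`: «every admissible competitor of C-min's ball is, in action, a chart point `e^{iD}W` with `D` Hermitian-traceless»)
# is PROVED at one member from COV — the conclusion of ✓`Prop7CovOfThm2.cov_of_thm2TorusAt` (itself [Balaban1985RegularSpaces] Theorem 2 in the form the knit displays as
# `hThm2`) — read at the background `U₀ := W` (the critical configuration, `W ∈ (6)(e) ∩ 𝔅_k(V)`): the competitor's axial representative relative to `W`
# (✓`Prop7ChartPrint.axialRepr_print_based_uniform`, with `|W̄ − V| = 0` by ✓`closeAvg_of_mem_fibre`) is charted by COV as `(U₁W)^u`, `U₁ = e^{iX}` with `X`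
# Hermitian-traceless ((19), ✓`In19`), and the three gauge transformations drop out of the action (5).  Also the member-level ADAPTER from the `Thm2TorusAt` socket to
# the based Theorem-2 binder `hT2m` of ✓`…MinimiserStabilityRegPrPV3EChart.isMinOn_regFibrePr_of_thm2_coercive142_at` (E′ line), so that ONE socket serves COV at `U₀`,
# CHART_W at `W`, and E′.

Cell `ym3-torus`, width seat `ym-ust-19200-w2` (gen 4; EX knit lineage).  THEOREMS ONLY (0 `def`, 0 `sorry`).  `--supports stmt-QuantumFields-19200 --as helper`,
count-neutral.  YM₃ on T³ is a ladder rung (R3), not the Clay problem; nothing here claims the stub, the crux, d = 4 or the mass gap.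

THE PRINT.  [Balaban1985Variational] p. 299: *«To see that U_k is a minimum we apply the whole procedure with the configuration U_k instead of U₀»* — Proposition 2
(p. 281: every `U′` of (6) near the background is `u(U₁U₀)` with `U₁ = e^{iηA}` in (19)–(21)) applied AT the critical configuration; (5) p. 278 (gauge invariance).
[Balaban1985RegularSpaces] Thm 2 p. 83, (1.19) p. 79 (axial gauge), (1.35) p. 82.

WHAT IS PROVED.  §1 ★★ **`exists_hermChart_of_cov_at`** — at one member: COV (the `∀`-body of `cov_of_thm2TorusAt`'s conclusion at `B₃ := 1`, constants `B₁′, c₁′`), `W, W_c ∈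
(6)(e) ∩ 𝔅_k(V)`, `e ≤ min{(6C₀(3))⁻¹, c₂′(3,L)∕4}`, `2e ≤ c₁′` ⟹ `∃ D` Hermitian-traceless with `A(W_c) = A(e^{iD}·W)` (`emb15 W (expHermField D)`).  §2 ★
**`thm2Based_member_of_thm2TorusAt`** — the based Theorem-2 binder at `(F, n, K)` from the socket `∀ F n K, ∃ β₀ B₂ len, Thm2TorusAt … B₁ … c₁ …`
(✓`thm2SetupSUAt_of_thm2TorusAt` ∘ ✓`Prop7SPrintThm2Dict.thm2Based_of_thm2SetupSUAt`).  HONEST SCOPE: plumbing over landed theorems; Theorem 2 itself stays the displayed socket.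

References: T. Bałaban, CMP 102 (1985) 277–309 [Balaban1985Variational] (Prop. 2 p.281, (5) p.278, (19)–(21) p.281, p.299); CMP 99 (1985) 75–102 [Balaban1985RegularSpaces]
(Thm 2 p.83, (1.19) p.79, (1.29) p.81, (1.33)–(1.39) pp.82–83).
-/

set_option autoImplicit false

noncomputable section

open scoped BigOperators Matrix.Norms.L2Operator Matrix

namespace Summit.QuantumFields.YangMills.Theorems.Prop7ChartWOfCov

open NormedSpace
open Literature.MathematicalPhysics.QuantumFieldTheory.Balaban1983to89
open Literature.MathematicalPhysics.QuantumFieldTheory.Balaban1983to89.T3ContinuumYM3Torus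
open Literature.MathematicalPhysics.QuantumFieldTheory.Balaban1983to89.T3UnitLawDensityEML (ℰp)
open Literature.MathematicalPhysics.QuantumFieldTheory.Balaban1983to89.T3ConstrainedMinimiser (fibre)
open Literature.MathematicalPhysics.QuantumFieldTheory.Balaban1983to89.T3PrintedRegularMinimiser (RegPr regFibrePr mem_regFibrePr_iff)
open Literature.MathematicalPhysics.QuantumFieldTheory.Balaban1983to89.T3PrintedRegularOrbits (descTransf gaugeAct_mem_regFibrePr_iff_of_trivial)
open Literature.MathematicalPhysics.QuantumFieldTheory.Balaban1983to89.T3Thm1Carrier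
open B7Prop1Explicit renaming Site → LSite
open B7Prop2Explicit (C0 c2' C0_pos c2'_pos)
open B7Prop2SpecialUnitary (specialUnitaryUnits)
open B8Thm4TorusAt (torusLam)
open B8Thm2TorusAt (Cond135T Thm2TorusAt C136T C139T)
open B8Thm2SetupTorus (thm2SetupSUAt_of_thm2TorusAt)
open B8Eq138LandauZd (IsLandau138)
open B10Eq27TorusAxialLog (pull unitsField toUField)
open T3SectALandauChart (pert emb15 eta bgUnits CloseAvg Sat14T3 In19 pos_of_regPr closeAvg_of_mem_fibre)
open Summit.QuantumFields.YangMills.Theorems.Prop7SPrint (basePt IsAxialPrint RestrictedPrint AvgCondPrint IsLandauPrint)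
open Summit.QuantumFields.YangMills.Theorems.Prop7ChartPrint (axialRepr_print_based_uniform)
open Summit.QuantumFields.YangMills.Theorems.Prop7SPrintThm2Dict (thm2Based_of_thm2SetupSUAt)
open Summit.QuantumFields.YangMills.Theorems.Prop7TPrint (expHermField expHermField_apply coe_expHerm)

/-! ## §1 CHART_W at one member from COV read at the critical background -/

/-- ★★ **CHART_W FROM COV AT THE CRITICAL BACKGROUND.**  At one member `(F, n, K)` of block size `L`: if COV holds (the conclusion of ✓`cov_of_thm2TorusAt` at `B₃ = 1`,
constants `B₁′, c₁′`), `W` and `W_c` both lie in `(6)(e) ∩ 𝔅_k(V)`, `e ≤ min{(6C₀(3))⁻¹, c₂′(3,L)∕4}` and `2e ≤ c₁′`, then there is a Hermitian-traceless `D` with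
`A(W_c) = A(e^{iD}·W)`: the competitor's axial representative relative to the background `W` (`v↓ = 1`) is charted by COV at `U₀ := W` as `(U₁W)^u`, `U₁ = e^{iX}`, `X`
Hermitian-traceless by (19), and `A(W_c) = A(W_c^v) = A((U₁W)^u) = A(U₁W)` by the gauge invariance of (5).
[cite: Balaban1985Variational, Prop. 2 p.281, (19) p.281, (5) p.278, p.299; Balaban1985RegularSpaces, Thm 2 p.83, (1.19) p.79, (1.35) p.82] -/
theorem exists_hermChart_of_cov_at {L : ℕ} (F : T3Family) (hF : F.L = L) {n K : ℕ} (hnK : n < K) {B₁' c₁' e : ℝ}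
    (hCOV : ∀ (F : T3Family) (hF : F.L = L) (n K : ℕ) (hnK : n < K) (ε₀ ε₁ ε₂ : ℝ), 0 < ε₀ → 0 < ε₁ →
        ε₀ + (L : ℝ) ^ 3 * ε₁ ≤ c₁' → B₁' * (ε₀ + (L : ℝ) ^ 3 * ε₁) ≤ ε₂ →
        ∀ (V : GaugeField (F.P n) 0 (Matrix.specialUnitaryGroup (Fin 2) ℂ)) (U₀ : GaugeField (F.P K) 0 (Matrix.specialUnitaryGroup (Fin 2) ℂ)),
          RegPr F n K ((L : ℝ) ^ 3 * 1 * ε₁) U₀ → CloseAvg F n K hnK.le ((L : ℝ) ^ 3 * ε₁) V U₀ →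
          ∀ U : GaugeField (F.P K) 0 (Matrix.specialUnitaryGroup (Fin 2) ℂ), U ∈ regFibrePr F n K hnK.le ε₀ V → IsAxialPrint F n K U₀ U →
            ∃ (u : GaugeTransf (F.P K) 0 (Matrix.specialUnitaryGroup (Fin 2) ℂ)) (U₁ : GaugeField (F.P K) 0 (Matrix.specialUnitaryGroup (Fin 2) ℂ))
              (X : PBond (F.P K) 0 → Matrix (Fin 2) (Fin 2) ℂ),
              RestrictedPrint F n K U₀ u ∧ GaugeField.gaugeAct u (emb15 U₀ U₁) = U ∧ In19 F n K ε₂ U₀ U₁ X ∧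
                AvgCondPrint F n K hnK.le V U₀ X ∧ IsLandauPrint F n K U₀ X)
    {V : GaugeField (F.P n) 0 (Matrix.specialUnitaryGroup (Fin 2) ℂ)} {W Wc : GaugeField (F.P K) 0 (Matrix.specialUnitaryGroup (Fin 2) ℂ)}
    (hW : W ∈ regFibrePr F n K hnK.le e V) (hWc : Wc ∈ regFibrePr F n K hnK.le e V)
    (heA : e ≤ min (1 / (6 * C0 3 * 1)) (c2' 3 L / (4 * 1))) (hec : e + e ≤ c₁') :
    ∃ D : PBond (F.P K) 0 → Matrix (Fin 2) (Fin 2) ℂ, (∀ b : PBond (F.P K) 0, (D b).IsHermitian ∧ Matrix.trace (D b) = 0) ∧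
      wilsonAction4 Wc = wilsonAction4 (emb15 W (expHermField D)) := by
  obtain ⟨hWfib, hWreg⟩ := (mem_regFibrePr_iff F).mp hW
  have he0 : 0 < e := pos_of_regPr F hWreg
  have hL0 : (0 : ℝ) < (L : ℝ) := by
    have h1 : 1 < F.L := F.hL.2
    rw [hF] at h1
    exact_mod_cast (lt_trans zero_lt_one h1)
  -- (1) the axial representative `Wc^v` of the competitor relative to the background `W`, `v↓ = 1`
  have h14 : Sat14T3 F n K hnK.le (1 * 1 * e) (1 * e) V W := by
    refine ⟨by rw [one_mul, one_mul]; exact hWreg, ?_⟩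
    rw [one_mul]; exact closeAvg_of_mem_fibre he0 hWfib
  obtain ⟨v, hv, hvAx⟩ := axialRepr_print_based_uniform F hF hnK.le le_rfl 1 e e V W Wc heA (by rw [one_mul]) h14 hWc
  have hvWc : GaugeField.gaugeAct v Wc ∈ regFibrePr F n K hnK.le e V := (gaugeAct_mem_regFibrePr_iff_of_trivial F hnK.le he0.le hv Wc V).mpr hWc
  have hax : IsAxialPrint F n K W (GaugeField.gaugeAct v Wc) := hvAx (torusLam (K - n))
  -- (2) COV at the background `W`: `ε₀ := e`, `L³ε₁ := e`, `ε₂ := B₁′(e + e)`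
  have hL3 : (0 : ℝ) < (L : ℝ) ^ 3 := by positivity
  have hε₁ : (L : ℝ) ^ 3 * (e / (L : ℝ) ^ 3) = e := by field_simp
  have hreg' : RegPr F n K ((L : ℝ) ^ 3 * 1 * (e / (L : ℝ) ^ 3)) W := by rw [mul_one, hε₁]; exact hWreg
  have hclose' : CloseAvg F n K hnK.le ((L : ℝ) ^ 3 * (e / (L : ℝ) ^ 3)) V W := by rw [hε₁]; exact closeAvg_of_mem_fibre he0 hWfib
  obtain ⟨u, U₁, X, -, hgauge, h19, -, -⟩ := hCOV F hF n K hnK e (e / (L : ℝ) ^ 3) (B₁' * (e + e)) he0 (by positivity)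
    (by rw [hε₁]; exact hec) (by rw [hε₁]) V W hreg' hclose' _ hvWc hax
  refine ⟨X, h19.1, ?_⟩
  -- (3) `U₁ = e^{iX}` bondwise and the three gauge transformations drop out of (5)
  have hU₁ : expHermField X = U₁ :=
    funext fun b => Subtype.ext (by rw [expHermField_apply, coe_expHerm (h19.1 b)]; exact (h19.2.1 b).symm)
  rw [hU₁]
  calc wilsonAction4 Wc = wilsonAction4 (GaugeField.gaugeAct v Wc) := (T4WilsonGaugeFlatDirection.wilsonAction_gaugeAct 1 v Wc).symm
    _ = wilsonAction4 (GaugeField.gaugeAct u (emb15 W U₁)) := by rw [hgauge]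
    _ = wilsonAction4 (emb15 W U₁) := T4WilsonGaugeFlatDirection.wilsonAction_gaugeAct 1 u _

/-! ## §2 The based Theorem-2 binder at one member from the `Thm2TorusAt` socket -/

/-- ★ **THE BASED THEOREM-2 BINDER AT ONE MEMBER FROM THE KNIT'S SOCKET**: if for every member of block size `L` [Balaban1985RegularSpaces] Theorem 2 holds in the
periodic-`ℤᵈ` form `Thm2TorusAt` at `G = SU(2)` with constants `B₁, c₁` (the knit's displayed `hThm2`, inner part), then at the member `(F, n, K)` the BASED binder `hT2m` of
✓`…PV3EChart.isMinOn_regFibrePr_of_thm2_coercive142_at` holds with the same `B₁, c₁` (✓`thm2SetupSUAt_of_thm2TorusAt` ∘ ✓`thm2Based_of_thm2SetupSUAt`).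
[cite: Balaban1985RegularSpaces, Thm 2 p.83, (1.33)-(1.39) pp.82-83; Balaban1985Variational, Prop. 2 p.281] -/
theorem thm2Based_member_of_thm2TorusAt {L : ℕ} {B₁ c₁ : ℝ}
    (hT : ∀ (F : T3Family), F.L = L → ∀ (n K : ℕ), n < K →
      ∃ (β₀ B₂ : ℝ) (len : LSite (F.P K).d → ℝ),
        Thm2TorusAt (F.P K).L (K - n) ((((F.P K).sitesPerDir 0 : ℕ) : ℤ)) (eta F n K) β₀ B₁ B₂ c₁ len (specialUnitaryUnits (Fin 2)) (fun _ => True))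
    (F : T3Family) (hF : F.L = L) {n K : ℕ} (hnK : n < K) :
    ∀ (α₀ α₁ : ℝ), 0 < α₀ → 0 < α₁ → α₀ + α₁ ≤ c₁ →
      ∀ (U₀ U : GaugeField (F.P K) 0 (Matrix.specialUnitaryGroup (Fin 2) ℂ)),
        RegPr F n K α₀ U₀ → RegPr F n K α₀ U → IsAxialPrint F n K U₀ U →
        Cond135T (F.P K).L (K - n) (pull (bgUnits F K U₀) (basePt F n K)) (pull (bgUnits F K (pert U₀ U)) (basePt F n K)) α₁ →
        ∃ (u : GaugeTransf (F.P K) 0 (Matrix.specialUnitaryGroup (Fin 2) ℂ))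
          (U₁ : GaugeField (F.P K) 0 (Matrix.specialUnitaryGroup (Fin 2) ℂ)) (A : PBond (F.P K) 0 → Matrix (Fin 2) (Fin 2) ℂ),
          RestrictedPrint F n K U₀ u ∧ GaugeField.gaugeAct u (emb15 U₀ U₁) = U ∧ (∀ b : PBond (F.P K) 0, IsSelfAdjoint (A b)) ∧
          (∀ b : PBond (F.P K) 0,
            ((U₁ b : Matrix.specialUnitaryGroup (Fin 2) ℂ) : Matrix (Fin 2) (Fin 2) ℂ) = exp (Complex.I • ((eta F n K) • A b))) ∧
          (∃ (β₀ B₂ : ℝ) (len : LSite (F.P K).d → ℝ),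
            C136T (F.P K).L (K - n) (eta F n K) β₀ B₁ B₂ len (α₀ + α₁) (pull (bgUnits F K U₀) (basePt F n K))
              (pull A (basePt F n K))) ∧
          IsLandau138 (F.P K).L (K - n) (eta F n K) (Set.univ : Set (LSite (F.P K).d)) (torusLam (K - n))
            (pull (bgUnits F K U₀) (basePt F n K)) (pull A (basePt F n K)) ∧
          C139T (F.P K).L (K - n) (eta F n K) B₁ (α₀ + α₁) (pull (bgUnits F K U₀) (basePt F n K)) (pull A (basePt F n K)) := by
  intro α₀ α₁ hα₀ hα₁ hc U₀ U h₀ hU hax h35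
  obtain ⟨β₀, B₂, len, h⟩ := hT F hF n K hnK
  obtain ⟨u, U₁, A, h1, h2, h3, h4, h36, h38, h39⟩ :=
    thm2Based_of_thm2SetupSUAt F (thm2SetupSUAt_of_thm2TorusAt h) hα₀ hα₁ hc U₀ U h₀ hU hax h35
  exact ⟨u, U₁, A, h1, h2, h3, h4, ⟨β₀, B₂, len, h36⟩, h38, h39⟩

end Summit.QuantumFields.YangMills.Theorems.Prop7ChartWOfCov

end
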